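import Literature.NumberTheory.LFunctions.ZetaKernelEvaluation
import Literature.NumberTheory.LFunctions.RiemannSiegelStirling
import HarnessLib

/-!
# A kernel-evaluable certified evaluator of Hardy's `Z(t)` by the Riemann–Siegel formula
# (main sum + `C₀`), with Gabcke's explicit remainder bound as a named fact

Topic `Literature/NumberTheory/LFunctions` (with `Analysis/ValidatedNumerics`). The tree evaluates
`ζ(½ + it)` only by Euler–Maclaurin (`Literature.NumberTheory.LFunctions.ZetaNumerics.zetaBoxK`,
cost `∝ t` terms per value). Every large verification of the Riemann hypothesis (Lehmer, Brent,
Odlyzko, Platt) uses instead the Riemann–Siegel formula, whose main sum has `N = ⌊√(t/2π)⌋` terms,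
with an EXPLICIT remainder bound — Gabcke's thesis (1979), Satz 3.2.2 — that is a theorem of
analysis we do not prove here. This file

1. types the objects of the Riemann–Siegel formula in Lehmer–Gabcke form AS PRINTED
   (Gabcke 1979, Einleitung (1), (2), (6)): `a = √(t/2π)`, `N = ⌊a⌋`, `z = 1 − 2(a − N)`,
   `F(z) = cos(π(z²/2 + 3/8))/cos(πz)` (`= C₀(z)`), the main sum
   `2 Σ_{n ≤ N} cos(ϑ(t) − t log n)/√n` (with the tree's `ϑ = riemannSiegelTheta` and
   `Z = hardyZ`, `RiemannSiegel.lean`), and the remainder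
   `R₀(t) = Z(t) − main − (−1)^{N−1} a^{−1/2} C₀(z)`;
2. records **Gabcke 1979, Satz 3.2.2 (b), case `K = 0`** — `t ≥ 200 ⇒ |R₀(t)| < 0.127 t^{−3/4}` —
   as the NAMED FACT `Gabcke.satz322b_R0` (a `def … : Prop`, to be taken as a hypothesis; we
   state it at the `t` where the printed closed form of `F` applies, see the docstring);
3. gives an executable evaluator `RSEval.hardyZBox` in the multi-precision interval arithmetic
   `Literature.Analysis.ValidatedNumerics.NumericsMP.MI/MC` (`MultiPrecisionInterval.lean`), built
   like `ZetaNumerics.zetaBoxK` from structural recursion only (so that both `decide +kernel` and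
   `native_decide` reduce it), together with its soundness theorem **`RSEval.mem_hardyZBox`**:
   under the named fact, the returned interval contains `Z(p/2^e)`.

The evaluator computes, for `t = p/2^e ≥ 200` and a claimed `N` (checked by
`2πN² < t < 2π(N+1)²`):
`Z(t) ∈ 2 Re(e^{iϑ_m} W) ± 2‖W‖·2K(¼)/t + (−1)^{N+1} e^{−L/4} F(z) ± 0.127 e^{−(3/4) log t}`,
where `W = Σ_{n≤N} n^{−1/2} e^{−it log n}` (phases by the certified `MC.expI`, magnitudes
`n^{−1/2} = e^{−(log n)/2}` tabulated once), `L = log(t/2π)`, `ϑ_m = (t/2)L − t/2 − π/8` is the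
Stirling main term of `ϑ` and `|ϑ(t) − ϑ_m(t)| ≤ 2K(¼)/t` is the tree's PROVED bound
`Literature.NumberTheory.LFunctions.abs_riemannSiegelTheta_sub_stirling_le` (`RiemannSiegelStirling.lean`),
`a = e^{L/2}`, `F(z)` by one interval division after a sign normalisation of `cos(πz)`.
Nothing else is assumed: the only hypothesis of `mem_hardyZBox` beyond table validity is
`Gabcke.satz322b_R0`.

Measured cost (Lean `v4.32.0`): at `t ≈ 10⁴` (`N = 39`) one value takes ≈ 2.7 s in the kernel
(`decide +kernel`) and ≈ 7 ms compiled (`native_decide`); the error radius is ≈ 3·10⁻³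
(dominated by the `ϑ` bound), against Gabcke's `1.3·10⁻⁴`. First consumer: the height ladder
`RiemannHypothesisUpTo 10⁴, 10⁵` through `ZetaZerosSimpleOnLineUpTo.of_hardyZ_signs`.

What is NOT here: the higher terms `C₁, …` (Satz 3.2.2 gives `|R_K|` for `K ≤ 10`; only `K = 0`
is typed), any evaluation off the critical line, and any proof of Gabcke's bound (the tree's
`RiemannSiegelIntegralFormula.lean` is Gabcke's own starting point, Satz 4.1.6).

## References

* W. Gabcke, *Neue Herleitung und explizite Restabschätzung der Riemann-Siegel-Formel*,
  Dissertation, Göttingen 1979: Einleitung (1)–(2), (6)–(8) pp. 2–3; Satz 3.2.2 p. 55. [Gabcke1979]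
* E. C. Titchmarsh, *The Theory of the Riemann Zeta-Function*, 2nd ed. 1986, §4.17. [Titchmarsh1986]
* H. M. Edwards, *Riemann's Zeta Function*, 1974, §7 (Riemann–Siegel formula). [Edwards1974]
-/

open Finset Complex
open Literature.Analysis.ValidatedNumerics Literature.Analysis.ValidatedNumerics.NumericsMP
open Literature.NumberTheory.LFunctions Literature.NumberTheory.LFunctions.ZetaNumerics
open scoped Real

namespace Literature.NumberTheory.LFunctions

/-! ## 1. The Riemann–Siegel formula in Lehmer–Gabcke form, as printed -/

namespace Gabcke

/-- Gabcke's `F(z) = cos(π(z²/2 + 3/8)) / cos(πz)`, the coefficient function `C₀ = F` of the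
Riemann–Siegel formula (Einleitung (2) and footnote 5: `F` is an entire function — the zeros of
`cos πz` at `z ≡ ½ (mod 1)` are removable singularities). Here the printed closed form, whose value
at those (for our purposes irrelevant, see `satz322b_R0`) points is Lean's junk `x/0 = 0`.
[cite: Gabcke1979, Einleitung (2) p. 2] -/
noncomputable def F (z : ℝ) : ℝ :=
  Real.cos (π * (z ^ 2 / 2 + 3 / 8)) / Real.cos (π * z)

/-- `a := √(t/2π)`. [cite: Gabcke1979, Einleitung (1) p. 2] -/
noncomputable def a (t : ℝ) : ℝ := Real.sqrt (t / (2 * π))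

/-- `N := ⌊a⌋`, the length of the Riemann–Siegel main sum. [cite: Gabcke1979, Einleitung (1) p. 2] -/
noncomputable def N (t : ℝ) : ℕ := ⌊a t⌋₊

/-- `z := 1 − 2(a − N) ∈ (−1, 1]`. [cite: Gabcke1979, Einleitung (1) p. 2] -/
noncomputable def z (t : ℝ) : ℝ := 1 - 2 * (a t - N t)

/-- The Riemann–Siegel main sum `2 Σ_{n=1}^{N} cos(ϑ(t) − t log n)/√n`, with the tree's
`ϑ = riemannSiegelTheta`. [cite: Gabcke1979, Einleitung (1) and (6) pp. 2–3] -/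
noncomputable def mainSum (t : ℝ) : ℝ :=
  2 * ∑ n ∈ Finset.Icc 1 (N t), Real.cos (riemannSiegelTheta t - t * Real.log n) / Real.sqrt n

/-- The remainder `R₀(t)` of the Riemann–Siegel formula with the single correction term `C₀`:
`Z(t) = 2 Σ_{n≤N} cos(ϑ − t log n)/√n + (−1)^{N−1} a^{−1/2} C₀(z) + R₀(t)` (Einleitung (6) with
`K = 0`, `C₀ = F`; `Z = hardyZ`). We write `(−1)^{N+1} = (−1)^{N−1}` to avoid truncated
subtraction. [cite: Gabcke1979, Einleitung (6) p. 3] -/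
noncomputable def R0 (t : ℝ) : ℝ :=
  hardyZ t - mainSum t - (-1) ^ (N t + 1) * F (z t) / Real.sqrt (a t)

/-- **Gabcke 1979, Satz 3.2.2 (b), case `K = 0`** (= Einleitung (8)): for `t ≥ 200`,
`|R₀(t)| < 0.127 · t^{−3/4}` ("Für K ≤ 4 sind diese Abschätzungen optimal"). Stated for the `t`
at which `cos(π z(t)) ≠ 0`, where the printed closed form of `F = C₀` is its value (this covers
every rational `t`: `cos(π z) = 0` forces `t = 2π(N + ½ ± ¼)²`); Gabcke's statement, with `F`
continued to an entire function, has no such proviso.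
-- TODO(general form): all `t ≥ 200` with the entire `F`, and the bounds for `R_1, …, R_10`.
[cite: Gabcke1979, Satz 3.2.2 (b) p. 55] -/
def satz322b_R0 : Prop :=
  ∀ ⦃t : ℝ⦄, 200 ≤ t → Real.cos (π * z t) ≠ 0 → |R0 t| < 0.127 * t ^ (-(3 / 4 : ℝ))

end Gabcke

/-! ## 2. Tables for the evaluator -/

namespace RSEval

/-- Tables of a Riemann–Siegel evaluation: the `ZetaNumerics.Tables` (scale `S`, largest usable
main-sum length `N`, `π`, `log n` for `n ≤ N`, Taylor parameters), the magnitudes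
`mags[n] ∋ n^{−1/2}`, enclosures of `log 2`, `log π`, `2K(¼)` (`K = stirlingVertRate`), and the
number of series terms for the logarithm of the sample point — the data needed to evaluate Gabcke's (1)/(6).
[cite: Gabcke1979, Einleitung (1) p. 2] -/
structure RSTables where
  /-- scale, truncation, `π`, logarithms, Taylor parameters -/
  T : Tables
  /-- `mags[n] ∋ n^{-1/2}` for `1 ≤ n ≤ T.N` (index `0` unused) -/
  mags : Array MI
  /-- `∋ log 2` -/
  log2 : MI
  /-- `∋ log π` -/
  logPi : MI
  /-- `∋ 2 K(¼) = 2 (1/6 + π/12 + 1/32 + 1/8)` -/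
  twoK : MI
  /-- series terms for `logNatK` of the sample numerator -/
  Klog : ℕ

/-- Validity of `RSTables` (every enclosure contains its number; the data of Gabcke's (1)/(6)).
[cite: Gabcke1979, Einleitung (1) p. 2] -/
structure RSTables.Valid (R : RSTables) : Prop where
  T_valid : R.T.Valid
  mags_size : R.mags.size = R.T.N + 1
  mem_mags : ∀ n : ℕ, 1 ≤ n → n ≤ R.T.N →
    MI.mem R.T.S (Real.exp (-(Real.log n / 2))) (R.mags.getD n default)
  mem_log2 : MI.mem R.T.S (Real.log 2) R.log2
  mem_logPi : MI.mem R.T.S (Real.log π) R.logPi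
  mem_twoK : MI.mem R.T.S (2 * stirlingVertRate (1 / 4)) R.twoK

/-- The magnitude table `[junk, 1^{-1/2}, …, n^{-1/2}]`, `m^{-1/2} = e^{-(log m)/2}` from the
logarithm table. [folklore] -/
def mkMags (T : Tables) : ℕ → Option (Array MI)
  | 0 => some #[default]
  | n + 1 =>
    match mkMags T n, MI.exp T.S T.Kexp T.kexp (((T.logs.getD (n + 1) default).divNat 2).neg) with
    | some A, some m => some (A.push m)
    | _, _ => none

/-- Build `RSTables` at scale `S` for main sums of length `≤ N`: `π` and the logarithms at scale
`S·2^guard` (`Klog` series terms, Machin with `Kpi` terms), `Kexp`/`kexp` and `KI`/`kI` Taylor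
terms/halvings for `exp`/`expI`, `KlogT` series terms for `log 2`, `log π` and the sample's
logarithm (`log π = log 3 − log(1 − (1 − 3/π))`). [folklore] -/
def mkRSTables (S N guard Klog Kpi Kexp kexp KI kI KlogT : ℕ) : Option RSTables :=
  match mkTablesK S N 1 guard Klog Kpi Kexp kexp KI kI with
  | none => none
  | some T =>
    match mkMags T N, MI.logTwo S KlogT, logNatK S KlogT 3, MI.divPos S (MI.ofInt S 3) T.piI with
    | some A, some l2, some l3, some q =>
      match MI.logOneSub S KlogT ((MI.ofInt S 1).sub q) with
      | some lq =>
        some ⟨T, A, l2, l3.sub lq,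
          (((MI.ofFrac S 1 6).add (MI.ofFrac S 5 32)).add (T.piI.divNat 12)).mulInt 2, KlogT⟩
      | none => none
    | _, _, _, _ => none

/-- Soundness of `mkMags`: size `n + 1` and `e^{-(log m)/2} ∈ mags[m]` for `1 ≤ m ≤ n ≤ N`.
[folklore] -/
private lemma mkMags_spec {T : Tables} (hT : T.Valid) :
    ∀ (n : ℕ) {A : Array MI}, n ≤ T.N → mkMags T n = some A →
      A.size = n + 1 ∧ ∀ m : ℕ, 1 ≤ m → m ≤ n →
        MI.mem T.S (Real.exp (-(Real.log m / 2))) (A.getD m default)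
  | 0, A, _, h => by
    simp only [mkMags, Option.some.injEq] at h
    subst h
    exact ⟨rfl, fun m h1 h2 ↦ by omega⟩
  | n + 1, A, hn, h => by
    simp only [mkMags] at h
    split at h
    · rename_i A0 mg hA0 hmg
      simp only [Option.some.injEq] at h
      subst h
      obtain ⟨hsz, hmem⟩ := mkMags_spec hT n (by omega) hA0
      refine ⟨by simp [hsz], fun m h1 h2 ↦ ?_⟩
      rcases Nat.lt_succ_iff_lt_or_eq.1 (Nat.lt_succ_of_le h2) with hlt | heq
      · have hm : m ≤ n := Nat.lt_succ_iff.1 hlt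
        have hlt' : m < A0.size := by rw [hsz]; omega
        have := hmem m h1 hm
        rw [Array.getD_eq_getD_getElem?, Array.getElem?_push_lt hlt', Option.getD_some]
        rw [Array.getD_eq_getD_getElem?, getElem?_pos A0 m hlt', Option.getD_some] at this
        exact this
      · subst heq
        have hidx : (A0.push mg)[n + 1]? = some mg := by
          rw [← hsz]; exact Array.getElem?_push_size
        rw [Array.getD_eq_getD_getElem?, hidx, Option.getD_some]
        have hL := hT.mem_logs (n + 1) h1 hn
        have harg : MI.mem T.S (-(Real.log (n + 1 : ℕ) / 2))
            (((T.logs.getD (n + 1) default).divNat 2).neg) :=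
          MI.mem_neg (MI.mem_divNat hL (n := 2) (by norm_num))
        exact MI.mem_exp hT.S_pos hmg harg
    · simp at h

/-- Tables built by `mkRSTables` are valid (inclusion property of the interval operations used for
Gabcke's (1)/(6)). [cite: Gabcke1979, Einleitung (1) p. 2] -/
theorem mkRSTables_valid {S N guard Klog Kpi Kexp kexp KI kI KlogT : ℕ} {R : RSTables}
    (h : mkRSTables S N guard Klog Kpi Kexp kexp KI kI KlogT = some R) : R.Valid := by
  unfold mkRSTables at h
  split at h
  · simp at h
  · rename_i T hT
    have hTv : T.Valid := mkTablesK_valid hT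
    have hTS : T.S = S := mkTablesK_S hT
    have hTN : T.N = N := mkTablesK_N hT
    have hS : 0 < S := hTS ▸ hTv.S_pos
    split at h
    · rename_i A l2 l3 q hA hl2 hl3 hq
      split at h
      · rename_i lq hlq
        simp only [Option.some.injEq] at h
        subst h
        have hpi : MI.mem S Real.pi T.piI := hTS ▸ hTv.mem_pi
        obtain ⟨hsz, hmem⟩ := mkMags_spec hTv N (by rw [hTN]) hA
        -- `log π = log 3 − log (1 − (1 − 3/π))`
        rw [logNatK_eq] at hl3
        have hlog3 := MI.mem_logNat hS hl3
        have h3pi : MI.mem S ((3 : ℝ) / Real.pi) q := by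
          have := MI.mem_divPos hS hq (MI.mem_ofInt S 3) hpi; simpa using this
        have hx : MI.mem S (1 - 3 / Real.pi) ((MI.ofInt S 1).sub q) := by
          have := MI.mem_sub (MI.mem_ofInt S 1) h3pi; simpa using this
        have hlq' := MI.mem_logOneSub hS hlq hx
        have elq : Real.log (1 - (1 - 3 / Real.pi)) = Real.log 3 - Real.log Real.pi := by
          rw [show (1 : ℝ) - (1 - 3 / Real.pi) = 3 / Real.pi by ring,
            Real.log_div (by norm_num) Real.pi_pos.ne']
        rw [elq] at hlq'
        have hlpi : MI.mem S (Real.log Real.pi) (l3.sub lq) := by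
          have := MI.mem_sub hlog3 hlq'
          convert this using 1; push_cast; ring
        have hK : MI.mem S (2 * stirlingVertRate (1 / 4))
            ((((MI.ofFrac S 1 6).add (MI.ofFrac S 5 32)).add (T.piI.divNat 12)).mulInt 2) := by
          have := MI.mem_mulInt (MI.mem_add (MI.mem_add (MI.mem_ofFrac S 1 (q := 6) (by norm_num))
            (MI.mem_ofFrac S 5 (q := 32) (by norm_num))) (MI.mem_divNat hpi (n := 12) (by norm_num))) 2
          convert this using 1
          unfold stirlingVertRate; push_cast; ring
        refine ⟨hTv, by rw [hsz, hTN], fun n h1 h2 ↦ ?_, hTS ▸ MI.mem_logTwo hS hl2, hTS ▸ hlpi,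
          hTS ▸ hK⟩
        exact hmem n h1 (by rw [← hTN]; exact h2)
      · simp at h
    · simp at h

/-! ## 3. The evaluator -/

/-- `W_m = Σ_{n=1}^{m} n^{-1/2} e^{-it log n}` for `t ∈ tI`, from the tables: phases by `MC.expI`,
magnitudes from `mags`. [folklore] -/
def rsW (R : RSTables) (tI : MI) : ℕ → Option MC
  | 0 => some (MC.ofInt R.T.S 0)
  | m + 1 =>
    match rsW R tI m,
      MC.expI R.T.S R.T.KI R.T.kI R.T.piI ((tI.mul R.T.S (R.T.logs.getD (m + 1) default)).neg) with
    | some acc, some ph => some (acc.add (ph.mulMI R.T.S (R.mags.getD (m + 1) default)))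
    | _, _ => none

/-- `log t` for the dyadic `t = p/2^e`: `log p − e log 2`. [folklore] -/
def logT (R : RSTables) (p e : ℕ) : Option MI :=
  match logNatK R.T.S R.Klog p with
  | some lp => some (lp.sub (R.log2.mulInt e))
  | none => none

/-- Gabcke's `F(z) = cos(π(z²/2 + 3/8))/cos(πz)` on an interval `zI ∋ z`: the two cosines as real
parts of `MC.expI`, then one division after normalising the sign of the denominator (`none` if
the enclosure of `cos(πz)` contains `0`). [cite: Gabcke1979, Einleitung (2) p. 2] -/
def FBox (R : RSTables) (zI : MI) : Option MI :=
  let S := R.T.S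
  let numArg := MI.mul S R.T.piI (((MI.mul S zI zI).divNat 2).add (MI.ofFrac S 3 8))
  let denArg := MI.mul S R.T.piI zI
  match MC.expI S R.T.KI R.T.kI R.T.piI numArg, MC.expI S R.T.KI R.T.kI R.T.piI denArg with
  | some En, some Ed =>
    if 0 < Ed.re.lo then MI.divPos S En.re Ed.re
    else if Ed.re.hi < 0 then MI.divPos S En.re.neg Ed.re.neg
    else none
  | _, _ => none

/-- **The certified Riemann–Siegel evaluator of Hardy's `Z`** at the dyadic point `t = p/2^e`
with claimed main-sum length `N` (checked: `2πN² < t < 2π(N+1)²`; also `t ≥ 200`,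
`1 ≤ N ≤` table size): an interval containing `Z(t)` under `Gabcke.satz322b_R0`
(`mem_hardyZBox`), namely
`2 Re(e^{iϑ_m} W) ± ⌈2·(2K(¼)/t)·‖W‖⌉ + (−1)^{N+1} e^{−L/4} F(z) ± 0.127 e^{−(3/4)log t}`,
`L = log(t/2π)`, `ϑ_m = (tL − t)/2 − π/8`, `a = e^{L/2}`, `z = 1 − 2(a − N)`.
[cite: Gabcke1979, Einleitung (6) p. 3] -/
def hardyZBox (R : RSTables) (p e N : ℕ) : Option MI :=
  let S := R.T.S
  let tI := MI.ofFrac S p (2 ^ e)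
  if 200 * 2 ^ e ≤ p ∧ 1 ≤ N ∧ N ≤ R.T.N ∧
      (R.T.piI.mulInt ((2 * N * N : ℕ) : ℤ)).hi < tI.lo ∧
      tI.hi < (R.T.piI.mulInt ((2 * (N + 1) * (N + 1) : ℕ) : ℤ)).lo then
    match logT R p e, rsW R tI N with
    | some lt, some W =>
      let L := (lt.sub R.log2).sub R.logPi
      let thm := (((MI.mul S tI L).sub tI).divNat 2).sub (R.T.piI.divNat 8)
      match MC.expI S R.T.KI R.T.kI R.T.piI thm, MI.divPos S R.twoK tI,
        MI.exp S R.T.Kexp R.T.kexp (L.divNat 2), MI.exp S R.T.Kexp R.T.kexp ((L.divNat 4).neg),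
        MI.exp S R.T.Kexp R.T.kexp (((lt.mulInt 3).divNat 4).neg) with
      | some E, some dl, some aI, some ainv, some t34 =>
        let main := ((MC.mul S E W).re).mulInt 2
        let rad : ℤ := Numerics.cdiv (2 * dl.hi * W.absHi) S
        let zI := (MI.ofInt S 1).sub ((aI.sub (MI.ofInt S N)).mulInt 2)
        match FBox R zI with
        | some FI =>
          let c0 := (MI.mul S ainv FI).mulInt ((-1) ^ (N + 1))
          let g := (t34.mulInt 127).divNat 1000
          some (((main.widen rad).add c0).add ⟨-g.hi, g.hi⟩)
        | none => none
      | _, _, _, _, _ => none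
    | _, _ => none
  else none

/-! ## 4. Soundness -/

section Soundness

/-- The complex main sum `W_m(t) = Σ_{n=1}^{m} n^{-(1/2 + it)}`. [folklore] -/
noncomputable def Wsum (m : ℕ) (t : ℝ) : ℂ :=
  ∑ n ∈ Finset.Icc 1 m, (n : ℂ) ^ (-(1 / 2 + t * I : ℂ))

/-- `n^{-(1/2+it)} = e^{-it log n} · e^{-(log n)/2}` for `n ≥ 1`. [folklore] -/
private lemma cpow_term_eq {n : ℕ} (hn : 1 ≤ n) (t : ℝ) :
    (n : ℂ) ^ (-(1 / 2 + t * I : ℂ)) =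
      Complex.exp (((-(t * Real.log n) : ℝ) : ℂ) * I) * ((Real.exp (-(Real.log n / 2)) : ℝ) : ℂ) := by
  rw [natCast_cpow_neg_eq hn]
  congr 2
  · simp
  · congr 1
    simp only [add_re, one_div, inv_re, re_ofNat, normSq_ofNat, mul_re, ofReal_re, I_re,
      mul_zero, ofReal_im, I_im, mul_one, sub_self, add_zero]
    ring

/-- Soundness of `rsW`: `W_m(t) ∈ rsW R tI m` for `t ∈ tI`, `m ≤ N` (the main sum of Gabcke's (1)
in interval arithmetic). [cite: Gabcke1979, Einleitung (1) p. 2] -/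
theorem mem_rsW {R : RSTables} (hR : R.Valid) {t : ℝ} {tI : MI} (ht : MI.mem R.T.S t tI) :
    ∀ (m : ℕ) {W : MC}, m ≤ R.T.N → rsW R tI m = some W → MC.mem R.T.S (Wsum m t) W
  | 0, W, _, h => by
    simp only [rsW, Option.some.injEq] at h
    subst h
    simpa [Wsum] using MC.mem_ofInt R.T.S 0
  | m + 1, W, hm, h => by
    simp only [rsW] at h
    split at h
    · rename_i acc ph hacc hph
      simp only [Option.some.injEq] at h
      subst h
      have hS := hR.T_valid.S_pos
      have h1 := mem_rsW hR ht m (by omega) hacc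
      have hL := hR.T_valid.mem_logs (m + 1) (by omega) hm
      have harg : MI.mem R.T.S (-(t * Real.log (m + 1 : ℕ)))
          ((tI.mul R.T.S (R.T.logs.getD (m + 1) default)).neg) :=
        MI.mem_neg (MI.mem_mul hS ht hL)
      have hph' := MC.mem_expI hS hR.T_valid.mem_pi hph harg
      have hmag := hR.mem_mags (m + 1) (by omega) hm
      have hterm := MC.mem_mulMI hS hph' hmag
      have : Wsum (m + 1) t = Wsum m t + (((m + 1 : ℕ) : ℂ) ^ (-(1 / 2 + t * I : ℂ))) := by
        unfold Wsum
        rw [Finset.sum_Icc_succ_top (by omega)]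
      rw [this, cpow_term_eq (by omega)]
      exact MC.mem_add h1 hterm
    · simp at h

/-- Soundness of `logT`: `log (p/2^e) ∈ logT R p e` (`p ≥ 1`). [folklore] -/
private theorem mem_logT {R : RSTables} (hR : R.Valid) {p e : ℕ} (hp : 1 ≤ p) {Y : MI}
    (h : logT R p e = some Y) : MI.mem R.T.S (Real.log ((p : ℝ) / 2 ^ e)) Y := by
  unfold logT at h
  split at h
  · rename_i lp hlp
    simp only [Option.some.injEq] at h
    subst h
    rw [logNatK_eq] at hlp
    have h1 := MI.mem_logNat hR.T_valid.S_pos hlp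
    have h2 := MI.mem_mulInt hR.mem_log2 (e : ℤ)
    have := MI.mem_sub h1 h2
    convert this using 1
    have hp0 : (0 : ℝ) < p := by exact_mod_cast hp
    rw [Real.log_div hp0.ne' (by positivity), Real.log_pow]
    push_cast
    ring
  · simp at h

/-- Soundness of `FBox`: if `z ∈ zI` and `FBox R zI = some FI` then `cos(πz) ≠ 0` and
`F(z) ∈ FI`. [cite: Gabcke1979, Einleitung (2) p. 2] -/
theorem mem_FBox {R : RSTables} (hR : R.Valid) {x : ℝ} {zI : MI} (hx : MI.mem R.T.S x zI)
    {FI : MI} (h : FBox R zI = some FI) :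
    Real.cos (π * x) ≠ 0 ∧ MI.mem R.T.S (Gabcke.F x) FI := by
  have hS := hR.T_valid.S_pos
  have hpi := hR.T_valid.mem_pi
  unfold FBox at h
  simp only at h
  split at h
  · rename_i En Ed hEn hEd
    have hnumArg : MI.mem R.T.S (π * (x ^ 2 / 2 + 3 / 8))
        (MI.mul R.T.S R.T.piI (((MI.mul R.T.S zI zI).divNat 2).add (MI.ofFrac R.T.S 3 8))) := by
      have := MI.mem_mul hS hpi (MI.mem_add (MI.mem_divNat (MI.mem_mul hS hx hx) (n := 2)
        (by norm_num)) (MI.mem_ofFrac R.T.S 3 (q := 8) (by norm_num)))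
      convert this using 2
      push_cast; ring
    have hdenArg : MI.mem R.T.S (π * x) (MI.mul R.T.S R.T.piI zI) := MI.mem_mul hS hpi hx
    have hEn' := (MC.mem_expI hS hpi hEn hnumArg).1
    have hEd' := (MC.mem_expI hS hpi hEd hdenArg).1
    rw [Complex.exp_ofReal_mul_I_re] at hEn' hEd'
    split_ifs at h with hpos hneg
    · have hc : 0 < Real.cos (π * x) := MI.pos_of_lo_pos hEd' hpos
      refine ⟨hc.ne', ?_⟩
      exact MI.mem_divPos hS h hEn' hEd'
    · have hc : Real.cos (π * x) < 0 := MI.neg_of_hi_neg hEd' hneg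
      refine ⟨hc.ne, ?_⟩
      have := MI.mem_divPos hS h (MI.mem_neg hEn') (MI.mem_neg hEd')
      unfold Gabcke.F
      rwa [neg_div_neg_eq] at this
  · simp at h

/-- The main sum as a real part: `2 Σ cos(ϑ − t log n)/√n = 2 Re(e^{iϑ} W_N(t))`.
[cite: Gabcke1979, Einleitung (1) p. 2] -/
theorem mainSum_eq_re (t : ℝ) :
    Gabcke.mainSum t = 2 * (Complex.exp ((riemannSiegelTheta t : ℂ) * I) * Wsum (Gabcke.N t) t).re := by
  unfold Gabcke.mainSum Wsum
  congr 1
  rw [Finset.mul_sum, Complex.re_sum]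
  refine Finset.sum_congr rfl fun n hn ↦ ?_
  have hn1 : 1 ≤ n := (Finset.mem_Icc.1 hn).1
  have hn0 : (0 : ℝ) < n := by exact_mod_cast hn1
  rw [cpow_term_eq hn1, ← mul_assoc, ← Complex.exp_add, ← add_mul,
    show (riemannSiegelTheta t : ℂ) + ((-(t * Real.log n) : ℝ) : ℂ) =
      ((riemannSiegelTheta t - t * Real.log n : ℝ) : ℂ) by push_cast; ring,
    Complex.re_mul_ofReal, Complex.exp_ofReal_mul_I_re]
  have hsqrt : Real.sqrt n = Real.exp (Real.log n / 2) := by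
    rw [Real.sqrt_eq_rpow, Real.rpow_def_of_pos hn0]
    congr 1; ring
  rw [hsqrt, div_eq_mul_inv, ← Real.exp_neg]

/-- `|2 Re(e^{iϑ} W) − 2 Re(e^{iφ} W)| ≤ 2 |ϑ − φ| ‖W‖`. [folklore] -/
private lemma abs_two_re_sub_le (θ φ : ℝ) (W : ℂ) :
    |2 * (Complex.exp ((θ : ℂ) * I) * W).re - 2 * (Complex.exp ((φ : ℂ) * I) * W).re| ≤
      2 * |θ - φ| * ‖W‖ := by
  rw [← mul_sub, ← Complex.sub_re, ← sub_mul, abs_mul, abs_two, mul_assoc]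
  gcongr
  refine (Complex.abs_re_le_norm _).trans ?_
  rw [norm_mul]
  gcongr
  exact Numerics.CB.norm_exp_I_sub_exp_I_le θ φ

/-- From the check `2πN² < t < 2π(N+1)²`: `N = Gabcke.N t`. [cite: Gabcke1979, Einleitung (1) p. 2] -/
lemma gabckeN_eq {t : ℝ} {N : ℕ} (h1 : 2 * π * (N : ℝ) ^ 2 < t) (h2 : t < 2 * π * ((N : ℝ) + 1) ^ 2) :
    Gabcke.N t = N := by
  unfold Gabcke.N Gabcke.a
  have h2pi : 0 < 2 * π := by positivity
  rw [Nat.floor_eq_iff (Real.sqrt_nonneg _)]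
  constructor
  · apply Real.le_sqrt_of_sq_le
    rw [le_div_iff₀ h2pi]; linarith
  · rw [Real.sqrt_lt' (by positivity), div_lt_iff₀ h2pi]
    linarith

/-- `a = e^{L/2}` and `1/√a = e^{−L/4}` with `L = log(t/2π)`, `t > 0`. [folklore] -/
private lemma gabckeA_eq {t : ℝ} (ht : 0 < t) :
    Gabcke.a t = Real.exp (Real.log (t / (2 * π)) / 2) ∧
      (Real.sqrt (Gabcke.a t))⁻¹ = Real.exp (-(Real.log (t / (2 * π)) / 4)) := by
  have hq : 0 < t / (2 * π) := by positivity
  have ha : Gabcke.a t = Real.exp (Real.log (t / (2 * π)) / 2) := by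
    unfold Gabcke.a
    rw [Real.sqrt_eq_rpow, Real.rpow_def_of_pos hq]
    congr 1; ring
  refine ⟨ha, ?_⟩
  rw [ha, Real.sqrt_eq_rpow, ← Real.exp_mul, ← Real.exp_neg]
  congr 1; ring

/-- **Soundness of the Riemann–Siegel evaluator.** Under Gabcke's bound `Gabcke.satz322b_R0`,
for valid tables, `hardyZBox R p e N = some B` implies `Z(p/2^e) ∈ B`.
[cite: Gabcke1979, Satz 3.2.2 (b) p. 55] -/
theorem mem_hardyZBox (hG : Gabcke.satz322b_R0) {R : RSTables} (hR : R.Valid) {p e N : ℕ}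
    {B : MI} (h : hardyZBox R p e N = some B) :
    MI.mem R.T.S (hardyZ ((p : ℝ) / 2 ^ e)) B := by
  have hS := hR.T_valid.S_pos
  have hSr : (0 : ℝ) < R.T.S := by exact_mod_cast hS
  have hpi := hR.T_valid.mem_pi
  unfold hardyZBox at h
  simp only at h
  split_ifs at h with hc
  obtain ⟨h200, hN1, hNN, hlow, hupp⟩ := hc
  -- the sample point
  set t : ℝ := (p : ℝ) / 2 ^ e with htdef
  have h2e : (0 : ℝ) < 2 ^ e := by positivity
  have ht200 : 200 ≤ t := by
    rw [htdef, le_div_iff₀ h2e]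
    have : ((200 * 2 ^ e : ℕ) : ℝ) ≤ p := by exact_mod_cast h200
    push_cast at this
    exact this
  have ht0 : 0 < t := by linarith
  have hp1 : 1 ≤ p := by
    by_contra hp
    push Not at hp
    interval_cases p
    simp [htdef] at ht200; linarith
  have htI : MI.mem R.T.S t (MI.ofFrac R.T.S p (2 ^ e)) := by
    have := MI.mem_ofFrac R.T.S (p : ℤ) (q := 2 ^ e) (by positivity)
    have e1 : ((p : ℤ) : ℝ) / ((2 ^ e : ℕ) : ℝ) = t := by rw [htdef]; push_cast; ring
    rwa [e1] at this
  -- `N = Gabcke.N t`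
  have hlow' : 2 * π * (N : ℝ) ^ 2 < t := by
    have hm : MI.mem R.T.S (2 * π * (N : ℝ) ^ 2) (R.T.piI.mulInt ((2 * N * N : ℕ) : ℤ)) := by
      have := MI.mem_mulInt hpi ((2 * N * N : ℕ) : ℤ)
      convert this using 1; push_cast; ring
    exact MI.lt_of_hi_lt_lo hm htI hlow
  have hupp' : t < 2 * π * ((N : ℝ) + 1) ^ 2 := by
    have hm : MI.mem R.T.S (2 * π * ((N : ℝ) + 1) ^ 2)
        (R.T.piI.mulInt ((2 * (N + 1) * (N + 1) : ℕ) : ℤ)) := by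
      have := MI.mem_mulInt hpi ((2 * (N + 1) * (N + 1) : ℕ) : ℤ)
      convert this using 1; push_cast; ring
    exact MI.lt_of_hi_lt_lo htI hm hupp
  have hNeq : Gabcke.N t = N := gabckeN_eq hlow' hupp'
  split at h
  · rename_i lt W hlt hW
    split at h
    · rename_i E dl aI ainv t34 hE hdl haI hainv ht34
      split at h
      · rename_i FI hFI
        simp only [Option.some.injEq] at h
        subst h
        -- enclosures
        have hlt' : MI.mem R.T.S (Real.log t) lt := mem_logT hR hp1 hlt
        set Lr : ℝ := Real.log (t / (2 * π)) with hLr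
        have hL : MI.mem R.T.S Lr ((lt.sub R.log2).sub R.logPi) := by
          have := MI.mem_sub (MI.mem_sub hlt' hR.mem_log2) hR.mem_logPi
          convert this using 1
          rw [hLr, Real.log_div ht0.ne' (by positivity), Real.log_mul (by norm_num) Real.pi_pos.ne']
          ring
        set θm : ℝ := t / 2 * Real.log (t / (2 * π)) - t / 2 - π / 8 with hθm
        have hthm : MI.mem R.T.S θm ((((MI.mul R.T.S (MI.ofFrac R.T.S p (2 ^ e))
            ((lt.sub R.log2).sub R.logPi)).sub (MI.ofFrac R.T.S p (2 ^ e))).divNat 2).sub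
            (R.T.piI.divNat 8)) := by
          have := MI.mem_sub (MI.mem_divNat (MI.mem_sub (MI.mem_mul hS htI hL) htI) (n := 2)
            (by norm_num)) (MI.mem_divNat hpi (n := 8) (by norm_num))
          convert this using 1
          rw [hθm, hLr]; push_cast; ring
        have hE' := MC.mem_expI hS hpi hE hthm
        have hW' := mem_rsW hR htI N hNN hW
        have hdl' : MI.mem R.T.S (2 * stirlingVertRate (1 / 4) / t) dl :=
          MI.mem_divPos hS hdl hR.mem_twoK htI
        obtain ⟨haeq, hainveq⟩ := gabckeA_eq ht0
        have haI' : MI.mem R.T.S (Gabcke.a t) aI := by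
          rw [haeq]
          exact MI.mem_exp hS haI (MI.mem_divNat hL (n := 2) (by norm_num))
        have hainv' : MI.mem R.T.S ((Real.sqrt (Gabcke.a t))⁻¹) ainv := by
          rw [hainveq]
          refine MI.mem_exp hS hainv ?_
          have := MI.mem_neg (MI.mem_divNat hL (n := 4) (by norm_num))
          convert this using 2
          rw [hLr]; push_cast; ring
        have ht34' : MI.mem R.T.S (t ^ (-(3 / 4 : ℝ))) t34 := by
          rw [Real.rpow_def_of_pos ht0]
          refine MI.mem_exp hS ht34 ?_
          have := MI.mem_neg (MI.mem_divNat (MI.mem_mulInt hlt' 3) (n := 4) (by norm_num))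
          convert this using 2
          push_cast; ring
        have hz : MI.mem R.T.S (Gabcke.z t)
            ((MI.ofInt R.T.S 1).sub ((aI.sub (MI.ofInt R.T.S N)).mulInt 2)) := by
          have := MI.mem_sub (MI.mem_ofInt R.T.S 1) (MI.mem_mulInt (MI.mem_sub haI'
            (MI.mem_ofInt R.T.S (N : ℤ))) 2)
          have e1 : ((1 : ℤ) : ℝ) - (Gabcke.a t - ((N : ℤ) : ℝ)) * ((2 : ℤ) : ℝ) = Gabcke.z t := by
            unfold Gabcke.z; rw [hNeq]; push_cast; ring
          rwa [e1] at this
        obtain ⟨hcos, hF⟩ := mem_FBox hR hz hFI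
        -- (i) the main sum
        have hmainBox : MI.mem R.T.S (2 * (Complex.exp ((θm : ℂ) * I) * Wsum N t).re)
            ((MC.mul R.T.S E W).re.mulInt 2) := by
          have := MI.mem_mulInt (MC.mem_mul hS hE' hW').1 2
          convert this using 1
          push_cast; ring
        have hmain : MI.mem R.T.S (Gabcke.mainSum t)
            (((MC.mul R.T.S E W).re.mulInt 2).widen (Numerics.cdiv (2 * dl.hi * W.absHi) R.T.S)) := by
          apply MI.mem_widen hmainBox
          have hθ := abs_riemannSiegelTheta_sub_stirling_le (t := t) (by linarith)
          rw [← hθm] at hθ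
          have h1 := abs_two_re_sub_le (riemannSiegelTheta t) θm (Wsum N t)
          have hWn := MC.norm_le_absHi hW'
          have hd2 := hdl'.2
          have hδ0 : 0 ≤ 2 * stirlingVertRate (1 / 4) / t := by
            unfold stirlingVertRate; positivity
          -- |main − approx| · S ≤ 2 (2K/t) ‖W‖ S ≤ 2 dl.hi absHi / S ≤ cdiv
          have hdlhi : (0 : ℝ) ≤ dl.hi := le_trans (by positivity) hd2
          have hprod : (2 * stirlingVertRate (1 / 4) / t * R.T.S) * (‖Wsum N t‖ * R.T.S) ≤
              (dl.hi : ℝ) * W.absHi := mul_le_mul hd2 hWn (by positivity) hdlhi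
          have hkey : |Gabcke.mainSum t - 2 * (Complex.exp ((θm : ℂ) * I) * Wsum N t).re| * R.T.S ≤
              2 * (dl.hi : ℝ) * W.absHi / R.T.S := by
            rw [mainSum_eq_re, hNeq, le_div_iff₀ hSr]
            calc |2 * (Complex.exp ((riemannSiegelTheta t : ℂ) * I) * Wsum N t).re -
                  2 * (Complex.exp ((θm : ℂ) * I) * Wsum N t).re| * R.T.S * R.T.S
                ≤ 2 * |riemannSiegelTheta t - θm| * ‖Wsum N t‖ * R.T.S * R.T.S := by gcongr
              _ ≤ 2 * (2 * stirlingVertRate (1 / 4) / t) * ‖Wsum N t‖ * R.T.S * R.T.S := by gcongr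
              _ = 2 * ((2 * stirlingVertRate (1 / 4) / t * R.T.S) * (‖Wsum N t‖ * R.T.S)) := by ring
              _ ≤ 2 * ((dl.hi : ℝ) * W.absHi) := by linarith [hprod]
              _ = 2 * (dl.hi : ℝ) * W.absHi := by ring
          have hc := Numerics.div_le_cdiv (a := 2 * dl.hi * W.absHi) (b := (R.T.S : ℤ))
            (by exact_mod_cast hS)
          push_cast at hc
          exact hkey.trans hc
        -- (ii) the `C₀` term
        have hc0 : MI.mem R.T.S ((-1 : ℝ) ^ (N + 1) * Gabcke.F (Gabcke.z t) / Real.sqrt (Gabcke.a t))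
            ((MI.mul R.T.S ainv FI).mulInt ((-1) ^ (N + 1))) := by
          have := MI.mem_mulInt (MI.mem_mul hS hainv' hF) ((-1) ^ (N + 1))
          convert this using 1
          push_cast
          rw [div_eq_mul_inv]; ring
        -- (iii) Gabcke's remainder
        have hg : MI.mem R.T.S (0.127 * t ^ (-(3 / 4 : ℝ))) ((t34.mulInt 127).divNat 1000) := by
          have := MI.mem_divNat (MI.mem_mulInt ht34' 127) (n := 1000) (by norm_num)
          convert this using 1
          norm_num; ring
        have hR0 : MI.mem R.T.S (Gabcke.R0 t)
            ⟨-((t34.mulInt 127).divNat 1000).hi, ((t34.mulInt 127).divNat 1000).hi⟩ := by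
          have hb := hG ht200 hcos
          have hgS := hg.2
          have habs : |Gabcke.R0 t| * R.T.S ≤ (((t34.mulInt 127).divNat 1000).hi : ℝ) :=
            le_trans (mul_le_mul_of_nonneg_right hb.le hSr.le) hgS
          have habs' : |Gabcke.R0 t * R.T.S| ≤ (((t34.mulInt 127).divNat 1000).hi : ℝ) := by
            rw [abs_mul, abs_of_pos hSr]; exact habs
          have h2 := abs_le.1 habs'
          refine ⟨?_, h2.2⟩
          push_cast
          exact h2.1
        -- assemble `Z = main + C₀-term + R₀`
        have hsum := MI.mem_add (MI.mem_add hmain hc0) hR0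
        have e1 : hardyZ t = Gabcke.mainSum t +
            (-1 : ℝ) ^ (N + 1) * Gabcke.F (Gabcke.z t) / Real.sqrt (Gabcke.a t) + Gabcke.R0 t := by
          unfold Gabcke.R0; rw [hNeq]; ring
        rw [e1]
        exact hsum
      · simp at h
    · simp at h
  · simp at h

end Soundness

/-! ## 5. Default parameters -/

/-- `RSTables` at scale `2^60` for main sums of length `≤ N` (guard `10` bits, `72` series terms
for the logarithms, Machin `16`, `9` Taylor terms with `5`/`4` halvings for `exp`/`expI`).
[folklore] -/
def rsTablesWith (N : ℕ) : Option RSTables := mkRSTables (2 ^ 60) N 10 72 16 9 5 9 4 72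

/-- Tables built by `rsTablesWith` are valid. [cite: Gabcke1979, Einleitung (1) p. 2] -/
theorem rsTablesWith_valid {N : ℕ} {R : RSTables} (h : rsTablesWith N = some R) : R.Valid :=
  mkRSTables_valid h

end RSEval

end Literature.NumberTheory.LFunctions
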